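import Summits.KontsevichZagierPeriods.Zeta5Search.Barrier.ConeGammaGapTable
import Literature.Analysis.ValidatedNumerics.DigammaKernelValues

/-!
# ζ(5) search — BARRIER: kernel ENCLOSURE of the digamma sum `Σ c_m (ψ(b_{m+1}) − ψ(b_m))` of a gap table

HONEST FRAMING (cell `pub-zeta5`): systematic search; no irrationality claim unless kernel-certified. MODEL objects
under Brown–Zudilin's (28)+(30) accounting ([BZ22] = arXiv:2210.03391); nothing here is a statement about `ζ(5)`;
records in print UNMOVED. Part 3/3 of the kernel evaluation of `Φ(a)` at ONE integer direction (seat P2 g13).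
Given a gap table `gs : List GapRec` (`ConeGammaGapTable`), the right-hand side of `phi30_eq_of_gapsCheck` is a
finite combination of digamma values at the rational breakpoints `b_1 < ⋯ < b_M = 1`; this file encloses it with
the tree's multi-precision interval engine (`Literature/Analysis/ValidatedNumerics`: `MI`/`MC` at scale `S`,
`MC.digammaBox` = shifted Stirling series with the proved Bernoulli table, `MI.piMachin`):

* `psiBox S K J P p q ∋ Re ψ(p/q)` (`mem_psiBox`);
* `phiAccFrom S K J P gs k₀ n` — ONE pass over the breakpoints `b_{k₀}, …, b_{k₀+n}` carrying
  `(Σ_{k₀ ≤ m < k₀+n} c_m(ψ(b_{m+1}) − ψ(b_m)), ψ(b_{k₀+n}))`, every `ψ(b_m)` evaluated once (`mem_phiAccFrom`); the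
  recursion depth is `n`, so long tables are cut into BANDS (`bandCheck` / **`bandSum_mem_of_bandCheck`**, glued by
  `bandSum_add` and `phiSum_eq_bandSum`) — the kernel's reduction depth, not its time, is the binding constraint;
* `phiCheck S Kpi K J gs LB UB` — the one-band test for a whole table, **`phiSum_mem_of_phiCheck`**:
  `LB/S ≤ Σ_{1 ≤ m < M} c_m (ψ(b_{m+1}) − ψ(b_m)) ≤ UB/S`;
* **`phi30_mem_of_checks`** — `gapsCheck a gs` ∧ `phiCheck … gs LB UB` ⇒ `Φ(a) ∈ [LB/S, UB/S]`.
-/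

noncomputable section

namespace Summit.KontsevichZagierPeriods.Zeta5Search.Barrier.ConeGamma

open Finset Set
open Literature.Analysis.ValidatedNumerics.NumericsMP

/-! ### `ψ` at a positive rational -/

/-- Enclosure of `Re ψ(p/q)` (`none` unless `q > 0` and the box is certified in the right half-plane). -/
def psiBox (S K J : ℕ) (P : MI) (p q : ℕ) : Option MI :=
  if q = 0 then none else
    match MC.digammaBox S K J P MC.bernoulliTable (MC.ofMI S (MI.ofFrac S (p : ℤ) q)) with
    | some Y => some Y.re
    | none => none

/-- `psiBox ∋ Re ψ(p/q)`. -/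
theorem mem_psiBox {S : ℕ} (hS : 0 < S) {K J : ℕ} {P : MI} (hP : MI.mem S Real.pi P) {p q : ℕ} {I : MI}
    (h : psiBox S K J P p q = some I) : MI.mem S (Complex.digamma (((p : ℝ) / q : ℝ) : ℂ)).re I := by
  unfold psiBox at h
  split_ifs at h with hq
  split at h
  · rename_i Y hY
    simp only [Option.some.injEq] at h
    subst h
    have hw : MC.mem S ((((p : ℝ) / q : ℝ)) : ℂ) (MC.ofMI S (MI.ofFrac S (p : ℤ) q)) := by
      have := MI.mem_ofFrac S (p : ℤ) (q := q) (Nat.pos_of_ne_zero hq)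
      push_cast at this
      exact MC.mem_ofMI this
    exact (MC.mem_digammaBox_table hS hP hY hw).1
  · simp at h

/-! ### One pass over a band of breakpoints -/

/-- The breakpoint `b_k` of a table as a pair `(numerator, denominator)` (`(1,1)` past the end). -/
def bptND (gs : List GapRec) (k : ℕ) : ℕ × ℕ := ((gs.getD k GapRec.dflt).loN, (gs.getD k GapRec.dflt).loD)

/-- `bpt` is the value of `bptND`. -/
theorem bpt_eq_bptND (gs : List GapRec) (k : ℕ) : bpt gs k = ((bptND gs k).1 : ℝ) / (bptND gs k).2 := rfl

/-- One term of the digamma sum: `c_m · Re(ψ(b_{m+1}) − ψ(b_m))`. -/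
def phiTerm (gs : List GapRec) (m : ℕ) : ℝ :=
  (cval gs m : ℝ) * (Complex.digamma ((bpt gs (m + 1) : ℝ) : ℂ) - Complex.digamma ((bpt gs m : ℝ) : ℂ)).re

/-- A band of the digamma sum: `Σ_{k₀ ≤ m < k₁} c_m · Re(ψ(b_{m+1}) − ψ(b_m))`. -/
def bandSum (gs : List GapRec) (k₀ k₁ : ℕ) : ℝ := ∑ m ∈ Finset.Ico k₀ k₁, phiTerm gs m

/-- The digamma sum of a table up to `k`: `Σ_{1 ≤ m < k} c_m · Re(ψ(b_{m+1}) − ψ(b_m))`. -/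
def phiSum (gs : List GapRec) (k : ℕ) : ℝ :=
  ∑ m ∈ Finset.Ico 1 k, (cval gs m : ℝ) *
    (Complex.digamma ((bpt gs (m + 1) : ℝ) : ℂ) - Complex.digamma ((bpt gs m : ℝ) : ℂ)).re

/-- `phiSum` is the band from `1`. -/
theorem phiSum_eq_bandSum (gs : List GapRec) (k : ℕ) : phiSum gs k = bandSum gs 1 k := rfl

/-- Consecutive bands add up. -/
theorem bandSum_add (gs : List GapRec) {a b c : ℕ} (hab : a ≤ b) (hbc : b ≤ c) :
    bandSum gs a b + bandSum gs b c = bandSum gs a c := by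
  unfold bandSum; exact Finset.sum_Ico_consecutive _ hab hbc

/-- Accumulator over the band starting at `k₀`: after `n` steps, the pair
`(box of Σ_{k₀ ≤ m < k₀+n} c_m (ψ(b_{m+1}) − ψ(b_m)), box of ψ(b_{k₀+n}))`; recursion depth `n`. -/
def phiAccFrom (S K J : ℕ) (P : MI) (gs : List GapRec) (k₀ : ℕ) : ℕ → Option (MI × MI)
  | 0 =>
    match psiBox S K J P (bptND gs k₀).1 (bptND gs k₀).2 with
    | some X => some (MI.ofInt S 0, X)
    | none => none
  | n + 1 =>
    match phiAccFrom S K J P gs k₀ n, psiBox S K J P (bptND gs (k₀ + n + 1)).1 (bptND gs (k₀ + n + 1)).2 with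
    | some AX, some Y => some (AX.1.add ((Y.sub AX.2).mulInt (cval gs (k₀ + n))), Y)
    | _, _ => none

/-- **Invariant of the pass**: the two boxes contain the band sum and `Re ψ(b_{k₀+n})`. -/
theorem mem_phiAccFrom {S : ℕ} (hS : 0 < S) {K J : ℕ} {P : MI} (hP : MI.mem S Real.pi P) (gs : List GapRec)
    (k₀ : ℕ) : ∀ n AX, phiAccFrom S K J P gs k₀ n = some AX →
      MI.mem S (bandSum gs k₀ (k₀ + n)) AX.1 ∧ MI.mem S (Complex.digamma ((bpt gs (k₀ + n) : ℝ) : ℂ)).re AX.2 := by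
  intro n
  induction n with
  | zero =>
    intro AX hAX
    simp only [phiAccFrom] at hAX
    split at hAX
    · rename_i X hX
      simp only [Option.some.injEq] at hAX
      subst hAX
      refine ⟨?_, ?_⟩
      · have : bandSum gs k₀ (k₀ + 0) = ((0 : ℤ) : ℝ) := by simp [bandSum]
        rw [this]; exact MI.mem_ofInt S 0
      · rw [Nat.add_zero, bpt_eq_bptND]; exact mem_psiBox hS hP hX
    · simp at hAX
  | succ n ih =>
    intro AX hAX
    simp only [phiAccFrom] at hAX
    split at hAX
    · rename_i AX' Y hAX' hY
      simp only [Option.some.injEq] at hAX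
      subst hAX
      obtain ⟨h1, h2⟩ := ih AX' hAX'
      have hY' := mem_psiBox hS hP hY
      rw [← bpt_eq_bptND] at hY'
      have hk : k₀ + (n + 1) = k₀ + n + 1 := by ring
      rw [hk]
      refine ⟨?_, hY'⟩
      have hsplit : bandSum gs k₀ (k₀ + n + 1) = bandSum gs k₀ (k₀ + n) + phiTerm gs (k₀ + n) := by
        unfold bandSum
        rw [Finset.sum_Ico_succ_top (by omega)]
      rw [hsplit]
      refine MI.mem_add h1 ?_
      have hsub := MI.mem_sub hY' h2
      rw [← Complex.sub_re] at hsub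
      have := MI.mem_mulInt hsub (cval gs (k₀ + n))
      simpa [phiTerm, mul_comm] using this
    · simp at hAX

/-! ### The tests and their soundness -/

/-- **Band test**: `π` by Machin (`Kpi` terms), every `ψ(b_m)`, `k₀ ≤ m ≤ k₀ + n`, by `digammaBox S K J`, and the box of
the band sum `Σ_{k₀ ≤ m < k₀+n}` inside `[LB, UB]` (scaled integers). -/
def bandCheck (S Kpi K J : ℕ) (gs : List GapRec) (k₀ n : ℕ) (LB UB : ℤ) : Bool :=
  match MI.piMachin S Kpi with
  | some P =>
    match phiAccFrom S K J P gs k₀ n with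
    | some AX => decide (LB ≤ AX.1.lo) && decide (AX.1.hi ≤ UB)
    | none => false
  | none => false

/-- **Soundness of `bandCheck`**: `LB/S ≤ Σ_{k₀ ≤ m < k₀+n} c_m (ψ(b_{m+1}) − ψ(b_m)) ≤ UB/S`. -/
theorem bandSum_mem_of_bandCheck {S : ℕ} (hS : 0 < S) {Kpi K J : ℕ} {gs : List GapRec} {k₀ n : ℕ} {LB UB : ℤ}
    (h : bandCheck S Kpi K J gs k₀ n LB UB = true) :
    (LB : ℝ) / S ≤ bandSum gs k₀ (k₀ + n) ∧ bandSum gs k₀ (k₀ + n) ≤ (UB : ℝ) / S := by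
  unfold bandCheck at h
  split at h
  · rename_i P hP
    split at h
    · rename_i AX hAX
      simp only [Bool.and_eq_true, decide_eq_true_eq] at h
      obtain ⟨hlo, hhi⟩ := h
      obtain ⟨⟨h1, h2⟩, _⟩ := mem_phiAccFrom hS (MI.mem_piMachin hS hP) gs k₀ n AX hAX
      have hSr : (0 : ℝ) < S := by exact_mod_cast hS
      have hlo' : (LB : ℝ) ≤ AX.1.lo := by exact_mod_cast hlo
      have hhi' : (AX.1.hi : ℝ) ≤ UB := by exact_mod_cast hhi
      constructor
      · rw [div_le_iff₀ hSr]; linarith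
      · rw [le_div_iff₀ hSr]; linarith
    · simp at h
  · simp at h

/-- **The one-band numerics test of a whole table** (`k₀ = 1`, `n = M − 1`). -/
def phiCheck (S Kpi K J : ℕ) (gs : List GapRec) (LB UB : ℤ) : Bool :=
  bandCheck S Kpi K J gs 1 (gs.length - 1) LB UB

/-- **Soundness of `phiCheck`**: `LB/S ≤ Σ_{1 ≤ m < M} c_m (ψ(b_{m+1}) − ψ(b_m)) ≤ UB/S`. -/
theorem phiSum_mem_of_phiCheck {S : ℕ} (hS : 0 < S) {Kpi K J : ℕ} {gs : List GapRec} (hM : 1 ≤ gs.length)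
    {LB UB : ℤ} (h : phiCheck S Kpi K J gs LB UB = true) :
    (LB : ℝ) / S ≤ phiSum gs gs.length ∧ phiSum gs gs.length ≤ (UB : ℝ) / S := by
  have hb := bandSum_mem_of_bandCheck hS h
  rwa [show 1 + (gs.length - 1) = gs.length by omega, ← phiSum_eq_bandSum] at hb

/-- **`Φ(a)` from the two kernel tests**: a passed gap table and a passed numerics test enclose `Φ(a)`. -/
theorem phi30_mem_of_checks {a : Fin 8 → ℤ} {gs : List GapRec} (hg : gapsCheck a gs = true) {S : ℕ} (hS : 0 < S)
    {Kpi K J : ℕ} {LB UB : ℤ} (hn : phiCheck S Kpi K J gs LB UB = true) (hM : 1 ≤ gs.length) :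
    phi30 (realDir a) ∈ Icc ((LB : ℝ) / S) ((UB : ℝ) / S) := by
  have heq : phi30 (realDir a) = phiSum gs gs.length := phi30_eq_of_gapsCheck hg
  rw [heq]
  exact phiSum_mem_of_phiCheck hS hM hn

/-- **`Φ(a)` from a gap table and TWO bands** `[1, k)` and `[k, M)` (for tables too long for one pass). -/
theorem phi30_mem_of_two_bands {a : Fin 8 → ℤ} {gs : List GapRec} (hg : gapsCheck a gs = true) {S : ℕ}
    (hS : 0 < S) {Kpi K J : ℕ} {k n₁ n₂ : ℕ} (hk : 1 + n₁ = k) (hM : k + n₂ = gs.length) {L₁ U₁ L₂ U₂ : ℤ}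
    (h₁ : bandCheck S Kpi K J gs 1 n₁ L₁ U₁ = true) (h₂ : bandCheck S Kpi K J gs k n₂ L₂ U₂ = true) :
    phi30 (realDir a) ∈ Icc (((L₁ : ℝ) + L₂) / S) (((U₁ : ℝ) + U₂) / S) := by
  have heq : phi30 (realDir a) = phiSum gs gs.length := phi30_eq_of_gapsCheck hg
  obtain ⟨a1, b1⟩ := bandSum_mem_of_bandCheck hS h₁
  obtain ⟨a2, b2⟩ := bandSum_mem_of_bandCheck hS h₂
  rw [hk] at a1 b1
  rw [hM] at a2 b2
  rw [heq, phiSum_eq_bandSum, ← bandSum_add gs (b := k) (by omega) (by omega), Set.mem_Icc, add_div, add_div]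
  constructor <;> linarith

end Summit.KontsevichZagierPeriods.Zeta5Search.Barrier.ConeGamma

end
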